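import Summits.QuantumFields.YangMills.Theorems.BalabanUVNodesN11K1SupportsOffOmegaTopReduction
import Summits.QuantumFields.YangMills.Theorems.BalabanUVNodesN11AllStepsQuadSlotZeroTerms

/-!
# DAG node N11 ∕ key K1⁹ — N11's OWN ROWS, THE 𝐓-LAWS, BY FIAT FROM SUPPORTS AT THE NON-Ω-TOP CHILDREN ONLY: next to every `θ` (and inside K1⁹'s hypothesis class from
# the three R-side conjuncts) a parameter with the SAME `Stage13RParams` data and `Phih` at which, for every run `p` and EVERY step `k`, the signs, `δ_k > 0` and the
# Gaussian-bare support inclusions «`0 < 𝐓ρ_k(s)(V) → 0 < I^G_p(s)(V)`» at the children `s` with `Ω_{k+1}(s) ≠ 𝕋` ALONE give `TLaw₁₃CoPH θ′ p k` with ZERO renormalization terms —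
# the Ω-top children (the small-field MAIN TERM among them) contribute NO hypothesis (count-neutral, LOCATED; FLAG №15 «N11∕K1⁹ 𝐓-LAW ROWS BY FIAT», certificate #5, 𝐓-side)

HEADER — WORK-UNIT METADATA.  Cell `pub-ymgap`, YM-PLAN Track A (HUMAN RULING D-0062), seat `pub-ymgap-dag-n11-d` (g36; N11 [B14], s2), route `BalabanUVNodes`, item K1⁹ =
stmt-QuantumFields-27364 (helper lane, `--kind proof --supports 27364 --as helper`, count-neutral).  [III] = [Balaban1988Convergent], [I] = [Balaban1987RG1].  Over this seat's
`…N11K1SupportsOmegaTopGaussianDial` (g36 K: `refNewSide_pos_of_Omega_univ`), `…N11K1SupportsOffOmegaTopReduction` (g36 L: `sect2Slot_gaussDial_eq_gaussBare`),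
`…N11K1SupportsAtUnitResidual` (g35 J: the unit-residual rows), `…N11AllStepsQuadSlotZeroTerms` (g34 E: `exists_zh_allSteps_tLaw_zeroTerms_of_supports[_of_hypotheses]` — EVERY 𝐓-law
modulo per-child supports, zero terms).

WHY.  FLAG №15 (director-ym №292) is about N11's own display: the 𝐓-law rows `TLaw₁₃CoPH θ p k` — «`𝐓ρ_k` has the §2 [III] form at the children of length `k+1` with the 𝐓-image laws» —
are met by fiat in K1⁹ v10 modulo per-child support conditions (g34 E).  The sequel L did the 𝐒-laws and K1⁹'s (B)-face; this file does the 𝐓-LAWS: with K's positivity the support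
condition «`0 < 𝐓ρ_k(s)(V) → 0 < J⁰_p(s)(V)`» is EMPTY at every Ω-top child, and at the other children it is the Gaussian-bare (R-level) inclusion of L §2.

WHAT THIS FILE PROVES (0 `sorry`, 0 `def`, standard axioms).  ★★★ `exists_zh_tLaw_zeroTerms_of_offTop_gaussSupports`: next to every `θ` there is `θ′` (same `Stage13RParams`, same `Phih`,
rows `zhLocal` ∕ `zhLaws` ∕ `ZhUnity` OUTRIGHT) such that for every run `p` and EVERY step `k`: signs `0 ≤ E₀, B₀`, nonnegative couplings `g_0 … g_{k+1}`, `δ_k > 0`, `0 ≤ 𝐓ρ_k(s)` and the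
Gaussian-bare supports at the children with `Ω_{k+1}(s) ≠ 𝕋` ⟹ `TLaw₁₃CoPH θ′ p k`.  ★★★★ `exists_zh_tLaw_zeroTerms_of_offTop_gaussSupports_of_hypotheses`: the same INSIDE K1⁹'s
hypothesis class — from ANY `θ` with `Provisos₁₃SepCoPH ∧ SlotsNondegenerate₁₃ ∧ Admissible` (`ZhUnity` NOT assumed: manufactured at the dial) a `θ′` carrying all FOUR conjuncts, at
which the signs, the couplings' sign, `δ_k > 0` and the off-top Gaussian-bare supports ALONE give every 𝐓-law (`0 ≤ 𝐓ρ_k` comes from the proviso rows).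

HONEST FRAMING.  Count-neutral LOCATED instrument; kernel bookkeeping over accepted declarations; nothing of Bałaban asserted or refuted; the off-top supports are HYPOTHESES, not
inhabited, NOT claimed at any `θ`; no K1⁹ witness; no `Stage13HParams` of record constructed or modified; N11 NOT discharged; K1⁹ NOT closed; no registered stub touched; counts
unmoved (typed 28∕28 · discharged 8∕27 = 8∕28 incl. NODE O).  One finite four-torus programme at fixed `ε = L^{−K}`; NOT ℝ⁴, NOT OS, NOT a mass gap, NOT Clay.  No `sorry`, `axiom`,
`def`, `instance`, `notation`.  Sources (SHAPE only): [III] Thm 1 p.262, remark p.262, (2.18) p.257, (2.21)–(2.23) p.258, (3.16) p.268, (3.21) p.269, (3.23)–(3.25) p.270, Def. p.279;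
[I] (0.20) p.256.
-/

noncomputable section

open MeasureTheory
open scoped BigOperators Matrix.Norms.L2Operator

namespace Summit.QuantumFields.YangMills.Theorems.BalabanUVNodesN11K1TLawsOffOmegaTopReduction

open Literature.MathematicalPhysics.QuantumFieldTheory.Balaban1983to89 T4Continuum
open Node00 Node00.Tk B14.Eq218Concrete B14.Sect3Decomp
open B10Eq42TorusConstraint (bondsIn)
open BalabanUVNodesN11TopPairQuadSlotK1Hypotheses (provisos₁₃SepCoPH_of_sameR slotsNondegenerate₁₃_of_sameR admissible_of_sameR)
open BalabanUVNodesN11K1SupportsAtUnitResidual (zhLaws_of_unitResidual zhLocal_of_unitResidual zhUnity_of_unitResidual)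
open BalabanUVNodesN11K1SupportsOmegaTopGaussianDial (refNewSide_pos_of_Omega_univ)
open BalabanUVNodesN11K1SupportsOffOmegaTopReduction (sect2Slot_gaussDial_eq_gaussBare)
open BalabanUVNodesN11AllStepsQuadSlotZeroTerms (exists_zh_allSteps_tLaw_zeroTerms_of_supports exists_zh_allSteps_tLaw_zeroTerms_of_supports_of_hypotheses)

variable {F : T4Family} {N : ℕ} [NeZero N]

/-- ★★★ **EVERY 𝐓-LAW OF THE RECORD BY FIAT FROM SUPPORTS AT THE NON-Ω-TOP CHILDREN ONLY** (g34 E at the Gaussian dial): next to every `θ` there is `θ′` with the SAME `Stage13RParams` data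
and `Phih`, rows `zhLocal` ∕ `zhLaws` ∕ `ZhUnity` holding OUTRIGHT, such that for every run `p` and EVERY step `k`: the signs `0 ≤ E₀, B₀`, nonnegative couplings `g_0, …, g_{k+1}`, print's
`δ_k > 0`, `0 ≤ 𝐓ρ_k(s)` and — ONLY at the children `s` of length `k+1` with `Ω_{k+1}(s) ≠ 𝕋` — a.e. on the `χ_{k+1}(s)`-support «`0 < 𝐓ρ_k(s)(V) → 0 < I^G_p(s)(V)`» (`I^G_p(s)` = 11a's
`𝐓_{k+1}(s)` with the Gaussian-bare weights `⟨1, Σ‖A‖², χ_A⟩`, zero terms, constant `e_p`, at the torus residual — R-LEVEL) ⟹ `TLaw₁₃CoPH θ′ p k`.  At the Ω-top children the support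
condition is EMPTY (K `refNewSide_pos_of_Omega_univ`).  LOCATED, count-neutral; nothing of Bałaban asserted; the off-top supports NOT claimed at any `θ`.
[cite: Balaban1988Convergent, Thm 1 p.262, remark p.262, (2.18) p.257, (2.21)–(2.23) p.258, (3.23)–(3.25) p.270, Def. p.279; Balaban1987RG1, (0.20) p.256] -/
theorem exists_zh_tLaw_zeroTerms_of_offTop_gaussSupports (θ : Stage13HParams F N) (e : B12.RunParams → ℝ) :
    ∃ θ' : Stage13HParams F N, θ'.toStage13RParams = θ.toStage13RParams ∧ θ'.Phih = θ.Phih ∧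
      (∀ p n Ω Λ, (θ'.Zh p n Ω Λ).LocalLaws) ∧ (∀ p n Ω Λ, (θ'.Zh p n Ω Λ).Laws) ∧ θ'.ZhUnity ∧
      ∀ (p : B12.RunParams) (k : ℕ), 0 ≤ θ.s2.lf.E₀ → 0 ≤ θ.s2.lf.B₀ → (∀ j, j ≤ k + 1 → 0 ≤ gOfRecord₁₃ F N θ.toStage13Params p j) →
        0 < deltaOfRecord θ.ν (gOfRecord₁₃ F N θ.toStage13Params p) k θ.A₁ →
        (∀ (s : SeqOfRecord F θ.ν θ.τ9.M (gOfRecord₁₃ F N θ.toStage13Params p) p.K (k + 1)) (V : GaugeField (F.P p.K) (k + 1) (SU N)),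
          0 ≤ slotsTOfRecord F N θ.ν θ.τ9 (EOfRecord₁₃ F N θ.toStage13Params) (wOfRecord₉ F N θ.toStage9Params) θ.ppSel p (gOfRecord₁₃ F N θ.toStage13Params p) (k + 1) s V) →
        (∀ s : SeqOfRecord F θ.ν θ.τ9.M (gOfRecord₁₃ F N θ.toStage13Params p) p.K (k + 1), s.Ω (k + 1) ≠ Set.univ →
          ∀ᵐ V ∂fieldMeasure (F.P p.K) (k + 1) (SU N), chiSeqOfRecord F N θ.ν θ.τ9.M (gOfRecord₁₃ F N θ.toStage13Params p) p.K (k + 1) s V ≠ 0 →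
            0 < slotsTOfRecord F N θ.ν θ.τ9 (EOfRecord₁₃ F N θ.toStage13Params) (wOfRecord₉ F N θ.toStage9Params) θ.ppSel p (gOfRecord₁₃ F N θ.toStage13Params p) (k + 1) s V →
            0 < sect2Slot F N (FluctV N) p.K (settingOfRecord₁₃ F N θ.toStage13Params p) (θ.Rz p.K)
              (⟨fun _ _ _ => 1, fun j Λ' ω => ∑ b ∈ (Set.toFinite (bondsIn j (Λ'ᶜ ∩ s.Ω (j + 1)))).toFinset, ‖(ω j).2 b‖ ^ 2,
                chiAW F N (FluctV N) θ.ν θ.A₁ p (gOfRecord₁₃ F N θ.toStage13Params p)⟩ : TkWeights F N (FluctV N) p.K)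
              s Sect2.TermValues.zero (e p) (UbgOfRecord₁₃CoP F N θ.toStage13Params p (k + 1) s) V) →
        TLaw₁₃CoPH F N θ' p k := by
  let θ₁ : Stage13HParams F N :=
    { θ with Zh := fun p _ Ω _ => ⟨fun j Y _ => Set.indicator {(Ω (j + 1))ᶜ} (1 : Set (Site (F.P p.K) 0) → ℝ) Y,
        fun j Λ' ω => ∑ b ∈ (Set.toFinite (bondsIn j (Λ'ᶜ ∩ Ω (j + 1)))).toFinset, ‖(ω j).2 b‖ ^ 2⟩ }
  have hζ : ∀ p n Ω Λ j Y ω, (θ₁.Zh p n Ω Λ).ζ0 j Y ω = Set.indicator {(Ω (j + 1))ᶜ} (1 : Set (Site (F.P p.K) 0) → ℝ) Y := fun _ _ _ _ _ _ _ => rfl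
  have hq : ∀ p n Ω Λ j Λ' ω, (θ₁.Zh p n Ω Λ).quad j Λ' ω = ∑ b ∈ (Set.toFinite (bondsIn j (Λ'ᶜ ∩ Ω (j + 1)))).toFinset, ‖(ω j).2 b‖ ^ 2 :=
    fun _ _ _ _ _ _ _ => rfl
  obtain ⟨θ', h1', h2', -, -, hloc, hlaws, hun, htl⟩ := exists_zh_allSteps_tLaw_zeroTerms_of_supports θ₁ e
  refine ⟨θ', h1', h2', hloc (zhLocal_of_unitResidual hζ), hlaws (zhLaws_of_unitResidual hζ), hun (zhUnity_of_unitResidual hζ),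
    fun p k hE₀ hB₀ hg hδ hT0 hsupp => htl p k hE₀ hB₀ hg hT0 fun s => ?_⟩
  by_cases hΩ : s.Ω (k + 1) = Set.univ
  · exact Filter.Eventually.of_forall fun V _ _ => refNewSide_pos_of_Omega_univ (𝔸 := MatA N) hζ hq p s hΩ hδ _ _ _ _ V
  · filter_upwards [hsupp s hΩ] with V hV hχ hT
    rw [sect2Slot_gaussDial_eq_gaussBare hζ hq p s]
    exact hV hχ hT

/-- ★★★★ **… INSIDE K1⁹'s HYPOTHESIS CLASS, UNITY MANUFACTURED**: from ANY `θ` with `Provisos₁₃SepCoPH ∧ SlotsNondegenerate₁₃ ∧ Admissible` there is `θ′` carrying K1⁹'s FOUR hypothesis-side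
conjuncts (`ZhUnity` included), same `Stage13RParams` and `Phih`, at which for every run `p` and EVERY step `k` the signs, the couplings' sign, `δ_k > 0` and the Gaussian-bare support
inclusions at the children with `Ω_{k+1}(s) ≠ 𝕋` ALONE give `TLaw₁₃CoPH θ′ p k` (`0 ≤ 𝐓ρ_k` from the proviso rows).  So inside the class N11's display asks of a K1⁹ witness NOTHING at the
small-field main term and every new-`R` child, and one R-level V-transport inclusion at each other child.  LOCATED, count-neutral.
[cite: Balaban1988Convergent, Thm 1 p.262, remark p.262, (2.18) p.257, (3.2)–(3.9) pp.265–266, (3.23)–(3.25) p.270, Def. p.279; Balaban1987RG1, (0.20) p.256] -/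
theorem exists_zh_tLaw_zeroTerms_of_offTop_gaussSupports_of_hypotheses (θ : Stage13HParams F N) (hP : θ.Provisos₁₃SepCoPH F N)
    (hS : θ.SlotsNondegenerate₁₃ F N) (hA : θ.Admissible F N) (e : B12.RunParams → ℝ) :
    ∃ θ' : Stage13HParams F N, θ'.toStage13RParams = θ.toStage13RParams ∧ θ'.Phih = θ.Phih ∧
      θ'.Provisos₁₃SepCoPH F N ∧ (θ'.ZhUnity ∧ θ'.SlotsNondegenerate₁₃ F N) ∧ θ'.Admissible F N ∧
      ∀ (p : B12.RunParams) (k : ℕ), 0 ≤ θ.s2.lf.E₀ → 0 ≤ θ.s2.lf.B₀ → (∀ j, j ≤ k + 1 → 0 ≤ gOfRecord₁₃ F N θ.toStage13Params p j) →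
        0 < deltaOfRecord θ.ν (gOfRecord₁₃ F N θ.toStage13Params p) k θ.A₁ →
        (∀ s : SeqOfRecord F θ.ν θ.τ9.M (gOfRecord₁₃ F N θ.toStage13Params p) p.K (k + 1), s.Ω (k + 1) ≠ Set.univ →
          ∀ᵐ V ∂fieldMeasure (F.P p.K) (k + 1) (SU N), chiSeqOfRecord F N θ.ν θ.τ9.M (gOfRecord₁₃ F N θ.toStage13Params p) p.K (k + 1) s V ≠ 0 →
            0 < slotsTOfRecord F N θ.ν θ.τ9 (EOfRecord₁₃ F N θ.toStage13Params) (wOfRecord₉ F N θ.toStage9Params) θ.ppSel p (gOfRecord₁₃ F N θ.toStage13Params p) (k + 1) s V →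
            0 < sect2Slot F N (FluctV N) p.K (settingOfRecord₁₃ F N θ.toStage13Params p) (θ.Rz p.K)
              (⟨fun _ _ _ => 1, fun j Λ' ω => ∑ b ∈ (Set.toFinite (bondsIn j (Λ'ᶜ ∩ s.Ω (j + 1)))).toFinset, ‖(ω j).2 b‖ ^ 2,
                chiAW F N (FluctV N) θ.ν θ.A₁ p (gOfRecord₁₃ F N θ.toStage13Params p)⟩ : TkWeights F N (FluctV N) p.K)
              s Sect2.TermValues.zero (e p) (UbgOfRecord₁₃CoP F N θ.toStage13Params p (k + 1) s) V) →
        TLaw₁₃CoPH F N θ' p k := by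
  let θ₁ : Stage13HParams F N :=
    { θ with Zh := fun p _ Ω _ => ⟨fun j Y _ => Set.indicator {(Ω (j + 1))ᶜ} (1 : Set (Site (F.P p.K) 0) → ℝ) Y,
        fun j Λ' ω => ∑ b ∈ (Set.toFinite (bondsIn j (Λ'ᶜ ∩ Ω (j + 1)))).toFinset, ‖(ω j).2 b‖ ^ 2⟩ }
  have hζ : ∀ p n Ω Λ j Y ω, (θ₁.Zh p n Ω Λ).ζ0 j Y ω = Set.indicator {(Ω (j + 1))ᶜ} (1 : Set (Site (F.P p.K) 0) → ℝ) Y := fun _ _ _ _ _ _ _ => rfl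
  have hq : ∀ p n Ω Λ j Λ' ω, (θ₁.Zh p n Ω Λ).quad j Λ' ω = ∑ b ∈ (Set.toFinite (bondsIn j (Λ'ᶜ ∩ Ω (j + 1)))).toFinset, ‖(ω j).2 b‖ ^ 2 :=
    fun _ _ _ _ _ _ _ => rfl
  have h1 : θ₁.toStage13RParams = θ.toStage13RParams := rfl
  have hP₁ : θ₁.Provisos₁₃SepCoPH F N := provisos₁₃SepCoPH_of_sameR h1 hP (zhLaws_of_unitResidual hζ) (zhLocal_of_unitResidual hζ)
  obtain ⟨θ', h1', h2', -, -, hP', hUS', hA', htl⟩ := exists_zh_allSteps_tLaw_zeroTerms_of_supports_of_hypotheses θ₁ hP₁ (zhUnity_of_unitResidual hζ)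
    (slotsNondegenerate₁₃_of_sameR h1 hS) (admissible_of_sameR h1 hA) e
  refine ⟨θ', h1', h2', hP', hUS', hA', fun p k hE₀ hB₀ hg hδ hsupp => htl p k hE₀ hB₀ hg fun s => ?_⟩
  by_cases hΩ : s.Ω (k + 1) = Set.univ
  · exact Filter.Eventually.of_forall fun V _ _ => refNewSide_pos_of_Omega_univ (𝔸 := MatA N) hζ hq p s hΩ hδ _ _ _ _ V
  · filter_upwards [hsupp s hΩ] with V hV hχ hT
    rw [sect2Slot_gaussDial_eq_gaussBare hζ hq p s]
    exact hV hχ hT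

end Summit.QuantumFields.YangMills.Theorems.BalabanUVNodesN11K1TLawsOffOmegaTopReduction

end
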